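import Summits.ResolutionOfSingularities.ResolutionOfSingularities.Theorems.EquisingularLiftEquisingularLiftNatF102SurjectiveModOfUnitSection
import Summits.ResolutionOfSingularities.ResolutionOfSingularities.Theorems.EquisingularLiftEquisingularLiftNatF102HomLift
import Summits.ResolutionOfSingularities.ResolutionOfSingularities.Theorems.EquisingularLiftEquisingularLiftNatF102SectionLineBundle
import Literature.AlgebraicGeometry.Modules.RankOneCocycle
import HarnessLib

/-!
# [OURS · L1 W4.5(b) · LINE (T-j)-PROOF · BRICK B4 modulo the special-fibre triviality (γ*)] The coordinate pair of the F-102 curve from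
# `i^*𝓗om(𝓘_{D₀}, 𝓘_{D₁}) ≅ 𝒪_{C_k}`

Crux chain w45b (cell `res-hironaka`), EL♮(3) stmt-ResolutionOfSingularities-20148, LINE (T-j)-PROOF of F-102
`Literature.AlgebraicGeometry.Resolution.GenusZeroOverCompleteDVR` (res-L1-w45b-lead-2 g3, skeleton v3 1683bb741349c142), BRICK B4
`F102.exists_coordinate_functions`. THIS FILE ASSEMBLES B4 from the landed sub-bricks, leaving exactly ONE hypothesis, the special-fibre
triviality (γ*) `hN : Nonempty (i^*𝓗om(𝓘_{s₀}, 𝓘_{s₁}) ≅ 𝒪_{Ck})` (dealt to res-L1-w45b-lead-2, desk res-L1-w45b-plan-1 2026-08-27T22:28:08Z):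
(a3) `isRegularImmersionOfCodim_one_of_section` (p578264, res-L1-type-o6) → (d) `exists_unitSection_sheafHom_idealModule_eq` (…NatF102HomLift,
res-L1-w45b-lead-2) → (d′) `surjective_mod_of_unitSection_eq` (p580898) → the global morphism `ū = homOfOverCover (u|)` (tree
`Modules.homOfOverCover`) → (e) `isIso_of_surjective_mod` (p579522) → (f) `exists_coordinate_functions_of_iso` (p578827).
OURS; NOT a statement of any manuscript; AI-written, weaker than expert review. No `sorry`; standard axioms; DEF-FREE.
`--supports stmt-ResolutionOfSingularities-20148 --as helper`. res-L1-type-o6 g30 (final cycle).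

* `homOfOverCover_top_app` — values of the morphism `E → M` made from `u : E|_⊤ → M|_⊤` by the tree's `Modules.homOfOverCover`.
* **`exists_coordinate_functions_of_trivial_pullback`** — B4 with the skeleton's binders `(O k θ C f) [IsProper f] [Flat f] (Ck i t) (hθ) (hreg)
  (hsq) (k') (e) (s₀ s₁) (hs₀) (hs₁)` plus `[IsIntegral C]` (G1 `isIntegral_of_isRegular`, p575507, discharges it under the skeleton's
  `[IsAdicComplete] [IsAlgClosed k]`) and `hN` = (γ*); the opens `W_j` are any opens missed by `s_j` (the skeleton's `sectionCompl`, where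
  `s_j⁻¹(C ∖ D_j) = ∅` is `by ext; simp`); `hz₀`, `hz₁`, `hdisj` of the skeleton are not needed here (they serve (γ*)).

References: R. Hartshorne, *Algebraic Geometry* (1977), II §5–§6, III §12 [cite: Hartshorne1977]; The Stacks Project, Tags 01CM, 01WQ
[cite: StacksProject].
-/

set_option linter.dupNamespace false -- mandated namespace `Summit.<Summit>.<Problem>` of this single-conjunct summit
set_option linter.overlappingInstances false -- signature carries `[IsDomain O] [IsDiscreteValuationRing O]`

noncomputable section

open CategoryTheory CategoryTheory.Limits AlgebraicGeometry Opposite TopologicalSpace IsLocalRing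
open Literature.AlgebraicGeometry.Modules Literature.AlgebraicGeometry.Morphisms Literature.AlgebraicGeometry
open Literature.AlgebraicGeometry.Morphisms (ProjCech.PP ProjCech.toSpec)
open Literature.AlgebraicGeometry.Deformation Literature.AlgebraicGeometry.Motives Literature.AlgebraicGeometry.HodgeTheory

namespace Summit.ResolutionOfSingularities.ResolutionOfSingularities.Cruxes.EquisingularLiftNat.F102

/-! ## A morphism over `⊤` is a morphism of modules -/

section Top

variable {C : Scheme.{0}} {E M : C.Modules}

/-- Values of the morphism `E → M` obtained from `u : E|_⊤ → M|_⊤` through the tree's `Modules.homOfOverCover` for the one-open cover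
`x ↦ ⊤`: `(ū)_V(a) = u_V(a)`. [folklore] -/
theorem homOfOverCover_top_app (u : E.over ⊤ ⟶ M.over ⊤) (V : C.Opens) (a : Γ(E, V)) :
    (homOfOverCover (W := fun _ : C => (⊤ : C.Opens)) (fun _ => trivial) (restrictHom (homOfLE le_top) u)).app V a =
      appLE u (homOfLE le_top) a := by
  rw [homOfOverCover_app, appLE_restrictHom]
  exact appLE_congr_hom u _ _ a

end Top

/-! ## B4 modulo (γ*) -/

/-- **BRICK B4 modulo the special-fibre triviality (γ*).** In the setting of F-102 (`O` a DVR with residue map `θ : O ↠ k`,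
`f : C → Spec O` proper and flat with `C` regular and integral, `(i, t; f, Spec θ)` the cartesian square of the closed fibre `Ck ≅ ℙ¹_{k'}`,
`s₀, s₁` sections of `f`), IF `i^*𝓗om(𝓘_{s₀}, 𝓘_{s₁}) ≅ 𝒪_{Ck}` (hypothesis `hN`, (γ*)), then for any opens `W₀`, `W₁` missed by `s₀`, `s₁`:
`∃ t₀ ∈ Γ(W₀, 𝒪_C), t₁ ∈ Γ(W₁, 𝒪_C)` with `t₀|·t₁| = 1` on `W₀ ∩ W₁`, `𝓘_{s₁}(V) = (t₀|_V)` for affine `V ⊆ W₀`, `𝓘_{s₀}(V) = (t₁|_V)` for affine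
`V ⊆ W₁` — the conclusion of `F102.exists_coordinate_functions`. [cite: Hartshorne1977, III Thm. 12.11] [OURS · L1 W4.5b · brick B4 mod (γ*)]
toward `F102.exists_coordinate_functions`; NOT a statement of the manuscript. -/
theorem exists_coordinate_functions_of_trivial_pullback (O : Type) [CommRing O] [IsDomain O] [IsDiscreteValuationRing O]
    (k : Type) [Field k] (θ : O →+* k) (C : Scheme.{0}) (f : C ⟶ Spec (.of O)) [IsProper f] [Flat f]
    (Ck : Scheme.{0}) (i : Ck ⟶ C) (t : Ck ⟶ Spec (.of k)) [IsIntegral C]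
    (hθ : Function.Surjective θ) (hreg : Resolution.Scheme.IsRegular C) (hsq : IsPullback i t f (Spec.map (CommRingCat.ofHom θ)))
    (k' : Type) [Field k'] (e : Ck ≅ ProjCech.PP k' 1)
    (s₀ s₁ : Spec (.of O) ⟶ C) (hs₀ : s₀ ≫ f = 𝟙 _) (hs₁ : s₁ ≫ f = 𝟙 _)
    (hN : Nonempty ((Scheme.Modules.pullback i).obj (sheafHom (idealModule s₀) (idealModule s₁)) ≅ unitModule Ck))
    (W₀ W₁ : C.Opens) (hW₀ : s₀ ⁻¹ᵁ W₀ = ⊥) (hW₁ : s₁ ⁻¹ᵁ W₁ = ⊥) :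
    ∃ (t₀ : Γ(C, W₀)) (t₁ : Γ(C, W₁)),
      C.presheaf.map (homOfLE (inf_le_left : W₀ ⊓ W₁ ≤ W₀)).op t₀ *
          C.presheaf.map (homOfLE (inf_le_right : W₀ ⊓ W₁ ≤ W₁)).op t₁ = 1 ∧
      (∀ V : C.affineOpens, ∀ hV : (V : C.Opens) ≤ W₀,
          s₁.ker.ideal V = Ideal.span {C.presheaf.map (homOfLE hV).op t₀}) ∧
      (∀ V : C.affineOpens, ∀ hV : (V : C.Opens) ≤ W₁,
          s₀.ker.ideal V = Ideal.span {C.presheaf.map (homOfLE hV).op t₁}) := by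
  haveI : IsLocallyNoetherian C := LocallyOfFiniteType.isLocallyNoetherian f
  have hP1 : ∃ (k' : Type) (_ : Field k'), Nonempty (Ck ≅ ProjCech.PP k' 1) := ⟨k', inferInstance, ⟨e⟩⟩
  have hr₀ := isRegularImmersionOfCodim_one_of_section O k θ C f Ck i t hθ hreg hsq hP1 s₀ hs₀
  have hr₁ := isRegularImmersionOfCodim_one_of_section O k θ C f Ck i t hθ hreg hsq hP1 s₁ hs₁
  haveI : IsClosedImmersion s₀ := hr₀.1
  haveI : IsClosedImmersion s₁ := hr₁.1
  obtain ⟨eN⟩ := hN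
  -- (d): lift the generator `eN⁻¹(1)`
  obtain ⟨u, hu⟩ := exists_unitSection_sheafHom_idealModule_eq O k θ C f Ck i t hθ hreg hsq k' e s₀ s₁ hs₀ hs₁ ⟨eN⟩
    (eN.inv.app (i ⁻¹ᵁ ⊤) (1 : Γ(Ck, i ⁻¹ᵁ ⊤)))
  -- a uniformiser
  obtain ⟨ϖ, hϖ⟩ := IsDiscreteValuationRing.exists_irreducible O
  have hϖm : ϖ ∈ maximalIdeal O := by rw [hϖ.maximalIdeal_eq]; exact Ideal.mem_span_singleton_self ϖ
  -- (d′): `u` is onto near the closed fibre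
  have hu' := surjective_mod_of_unitSection_eq θ f i t s₀ s₁ hθ hsq hr₀ hr₁ eN u hu ϖ
  -- the global morphism and (e)
  set ū : idealModule s₀ ⟶ idealModule s₁ := homOfOverCover (W := fun _ : C => (⊤ : C.Opens)) (fun _ => trivial)
    (restrictHom (homOfLE le_top) (u : (idealModule s₀).over ⊤ ⟶ (idealModule s₁).over ⊤)) with hū
  haveI : IsIso ū := by
    refine isIso_of_surjective_mod f s₀ s₁ ū hr₀ hr₁ ϖ hϖm fun x hx => ?_
    obtain ⟨Vx, hxVx, hV⟩ := hu' x hx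
    refine ⟨Vx, hxVx, fun V hle b => ?_⟩
    obtain ⟨a, c, h⟩ := hV V hle b
    exact ⟨a, c, by rw [hū, homOfOverCover_top_app]; exact h⟩
  -- (f)
  exact exists_coordinate_functions_of_iso s₀ s₁ W₀ W₁ hW₀ hW₁ (asIso ū)

end Summit.ResolutionOfSingularities.ResolutionOfSingularities.Cruxes.EquisingularLiftNat.F102

end
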